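import Summits.QuantumFields.BalabanUV.Beta.FP.ExpLocalisedBubbleProduct

/-!
# `BalabanUV.Beta.FP.TadpoleSmearBridge` — road «FP», N7 H-route, row H2-ASM-1b (tadpole half): THE ONE-LOOP TADPOLE `ExpKernelCalculus.tadpole A W₂`
# (nested `tr∘comp` tsums over a finite fibre) REWRITTEN AS A FINITE SUM OF FLAT SINGLE SMEARS over `ℤ⁴×ℤ⁴` — the input shape of `FP/ExpLocalisedBubble{,Point}`
# ([folklore] absolutely convergent rearrangement; nothing of the manuscripts)

HONEST DEPENDENCY (page 1, mandatory): continuum YM on T⁴ ⇐ BetaPertH ∧ nine spine estimates (0/9 proved); BetaPertH ⇐ (D1) ∧ (D4) ∧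
CAP+tail; G-an2-4 gates asym, D1 and NE2/3/4.  HONEST FRAMING (cell contract, verbatim): «discharging `BetaPertH` makes Bałaban's UV
stability UNCONDITIONAL — a real constructive-QFT result; it is NOT the continuum limit and NOT the Clay problem.»  THIS MODULE is elementary [folklore] real
analysis (Fubini for an absolutely summable family on `ℤ⁴×ℤ⁴`, finite fibre sums); every analytic input (a BOUNDED leg kernel `A`, a BI-LOCALISED second-order vertex `W₂`)
is a HYPOTHESIS; no `def`, no `Prop` fact, nothing cited, 0 sorry.  NOT the perfect tadpole's VALUE, NOT `hgerm`, NOT D1, NOT BetaPertH, NOT continuum, NOT Clay.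

ROW (road FP owner d1-p3-g7 «GO, THIS SHAPE … and the tadpole one-liner (wanted: H2-ASM-3 needs both shapes)», journal 01:16:45Z on OFFER l.24320): companion of
`FP/BubbleSmearBridge` (p244001).  `hessKer A V W μ ν z = ½·tadpole A (W μ 0 ν z) − ½·bubble A (V μ 0) (V ν z)`; the bubble half is there, the tadpole half is here.

CONTENT (`Pt = ℤ⁴`, finite fibre `Φ`; `A W₂ : MKer 4 Φ`; `|A x y a b| ≤ CA`, `BiLoc W₂ 0 z Cw δ`, `δ > 0`).
* `loc_vertex₂` (`|W₂ p.2 (z + p.1) f a| ≤ Cw·e^{−δ|p.1|₁}e^{−δ|p.2|₁}` — the engine's two-point weight currency), `summable_tad_flat`;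
* **`tadpole_eq_sum_tsum`**: `tadpole A W₂ = Σ_{a f} Σ'_{p : Pt×Pt} W₂ p.2 (z + p.1) f a · A (z + p.1) p.2 a f`;
* **`tadpole_eq_sum_smear`** (translation-invariant `A`): `= Σ_{a f} Σ'_p W₂ p.2 (z+p.1) f a · A 0 (−(z + p.1 − p.2)) a f` — LITERALLY `Σ_{af} Σ' c p·F(z+p.1−p.2)` with
  `c p := W₂ p.2 (z+p.1) f a`, `F v := A 0 (−v) a f`, the object of `FP/ExpLocalisedBubble.abs_smear_sub_order0∕1_le` ∕ `…Point` ∕ `…Marginals.abs_smear_le`.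
Unit `b2b-balaban-beta-d1-formalise-leaf-02` (gen 8).
-/

noncomputable section

namespace Summit.QuantumFields.BalabanUV.Beta.FP.TadpoleSmearBridge

open Finset Filter Topology
open scoped BigOperators
open Literature.MathematicalPhysics.QuantumFieldTheory.Balaban1983to89
open Literature.MathematicalPhysics.QuantumFieldTheory.Balaban1983to89.Beta
open B12Sec2to5 (l1 l1_nonneg)
open ExpKernelCalculus (Site MKer Zl Zl_pos BiLoc comp tr tadpole shiftK)
open Summit.QuantumFields.BalabanUV.Beta.FP.ExpLocalisedBubble (summable_weight)
open DyadicShell (Pt)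

variable {Φ : Type*} [Fintype Φ]
variable {A W₂ : MKer 4 Φ} {CA Cw δ : ℝ} {z : Pt}

omit [Fintype Φ] in
/-- [folklore] The second-order vertex (legs at `0` and at `z`) as a two-point weight in the engine's currency: `p = (x′, y)`, `x = z + x′`. -/
theorem loc_vertex₂ (hW : BiLoc W₂ 0 z Cw δ) (f a : Φ) :
    ∀ p : Pt × Pt, |W₂ p.2 (z + p.1) f a| ≤ Cw * (Real.exp (-δ * l1 p.1) * Real.exp (-δ * l1 p.2)) := fun p => by
  have h := hW p.2 (z + p.1) f a
  rw [sub_zero, add_sub_cancel_left, show -δ * (l1 p.2 + l1 p.1) = -δ * l1 p.1 + -δ * l1 p.2 by ring, Real.exp_add] at h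
  exact h

omit [Fintype Φ] in
/-- [folklore] TRANSLATION INVARIANCE READ POINTWISE: `shiftK v A = A` for all `v` ⟹ `A x y = A 0 (y − x)`. -/
theorem transl_apply (hT : ∀ v : Pt, shiftK v A = A) (x y : Pt) (a b : Φ) : A x y a b = A 0 (y - x) a b := by
  have h := congrFun (congrFun (congrFun (congrFun (hT (-x)) x) y) a) b
  simp only [shiftK] at h
  rw [← h, add_neg_cancel, ← sub_eq_add_neg]

omit [Fintype Φ] in
/-- [folklore] The flat tadpole family `(x, y) ↦ A x y a f·W₂ y x f a` is summable. -/
theorem summable_tad_flat (hδ : 0 < δ) (hA : ∀ x y a b, |A x y a b| ≤ CA) (hW : BiLoc W₂ 0 z Cw δ) (a f : Φ) :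
    Summable fun X : Pt × Pt => A X.1 X.2 a f * W₂ X.2 X.1 f a := by
  have hCA : 0 ≤ CA := (abs_nonneg _).trans (hA 0 0 a a)
  have hw := (summable_weight hδ (loc_vertex₂ hW f a)).abs
  -- reindex the majorant `p = (x′, y) ↦ |W₂ y (z + x′)|` to `(x, y) = (z + x′, y)`
  let e : Pt × Pt ≃ Pt × Pt :=
    { toFun := fun p => (z + p.1, p.2)
      invFun := fun X => (X.1 - z, X.2)
      left_inv := fun p => by obtain ⟨x', y⟩ := p; simp
      right_inv := fun X => by obtain ⟨x, y⟩ := X; simp }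
  have hw' : Summable fun X : Pt × Pt => |W₂ X.2 X.1 f a| := by
    have := (e.symm.summable_iff).mpr hw
    refine this.congr fun X => ?_
    obtain ⟨x, y⟩ := X
    simp [e, Function.comp]
  refine Summable.of_norm_bounded (hw'.mul_left CA) (fun X => ?_)
  rw [Real.norm_eq_abs, abs_mul]
  exact mul_le_mul_of_nonneg_right (hA X.1 X.2 a f) (abs_nonneg _)

/-- **THE TADPOLE IS A FINITE SUM OF FLAT TWO-LEG SUMS**: `tadpole A W₂ = Σ_{a f} Σ'_{p : Pt×Pt} W₂ p.2 (z+p.1) f a · A (z+p.1) p.2 a f` (`p = (x′, y)`: the vertex's leg `y`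
near `0`, its leg `x = z + x′` near `z`; absolutely convergent rearrangement of `tr (A∘W₂)`). [folklore] -/
theorem tadpole_eq_sum_tsum (hδ : 0 < δ) (hA : ∀ x y a b, |A x y a b| ≤ CA) (hW : BiLoc W₂ 0 z Cw δ) :
    tadpole A W₂ = ∑ a, ∑ f, ∑' p : Pt × Pt, W₂ p.2 (z + p.1) f a * A (z + p.1) p.2 a f := by
  classical
  have e0 : tadpole A W₂ = ∑' x : Pt, ∑ a, ∑' y : Pt, ∑ f, A x y a f * W₂ y x f a := rfl
  set T : Φ → Φ → Pt × Pt → ℝ := fun a f X => A X.1 X.2 a f * W₂ X.2 X.1 f a with hT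
  have hTs : ∀ a f, Summable (T a f) := fun a f => summable_tad_flat hδ hA hW a f
  set S : Pt × Pt → ℝ := fun X => ∑ a, ∑ f, T a f X with hS
  have hSs : Summable S := summable_sum fun a _ => summable_sum fun f _ => hTs a f
  have step2 : tadpole A W₂ = ∑' X, S X := by
    rw [e0, hSs.tsum_prod]
    refine tsum_congr fun x => ?_
    simp only [hS]
    have hx : ∀ a, Summable fun y : Pt => ∑ f, T a f (x, y) := fun a => summable_sum fun f _ => (hTs a f).prod_factor x
    rw [Summable.tsum_finsetSum (fun a _ => hx a)]
  rw [step2]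
  simp only [hS]
  rw [Summable.tsum_finsetSum (fun a _ => summable_sum fun f _ => hTs a f)]
  refine Finset.sum_congr rfl fun a _ => ?_
  rw [Summable.tsum_finsetSum (fun f _ => hTs a f)]
  refine Finset.sum_congr rfl fun f _ => ?_
  let e : Pt × Pt ≃ Pt × Pt :=
    { toFun := fun p => (z + p.1, p.2)
      invFun := fun X => (X.1 - z, X.2)
      left_inv := fun p => by obtain ⟨x', y⟩ := p; simp
      right_inv := fun X => by obtain ⟨x, y⟩ := X; simp }
  rw [← e.tsum_eq]
  exact tsum_congr fun p => by simp only [hT, e, Equiv.coe_fn_mk]; ring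

/-- **THE TADPOLE IS A FINITE SUM OF SINGLE SMEARS** (translation-invariant leg): `tadpole A W₂ = Σ_{a f} Σ'_p W₂ p.2 (z+p.1) f a · A 0 (−(z + p.1 − p.2)) a f` — LITERALLY
`Σ_{af} Σ' c p·F(z+p.1−p.2)` with `c p := W₂ p.2 (z+p.1) f a` (localised by `loc_vertex₂`) and `F v := A 0 (−v) a f`. [folklore] -/
theorem tadpole_eq_sum_smear (hδ : 0 < δ) (hA : ∀ x y a b, |A x y a b| ≤ CA) (hT : ∀ v : Pt, shiftK v A = A) (hW : BiLoc W₂ 0 z Cw δ) :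
    tadpole A W₂ = ∑ a, ∑ f, ∑' p : Pt × Pt, W₂ p.2 (z + p.1) f a * A 0 (-(z + p.1 - p.2)) a f := by
  rw [tadpole_eq_sum_tsum hδ hA hW]
  refine Finset.sum_congr rfl fun a _ => Finset.sum_congr rfl fun f _ => tsum_congr fun p => ?_
  rw [transl_apply hT (z + p.1) p.2 a f, neg_sub]

end Summit.QuantumFields.BalabanUV.Beta.FP.TadpoleSmearBridge

end
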